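import Summits.BirchSwinnertonDyer.BirchSwinnertonDyer.Theorems.GenusKolyvaginAtTwoGenusPrimitiveSupplyAtTwoPrimeTwistInert
import Summits.BirchSwinnertonDyer.BirchSwinnertonDyer.Theorems.GenusKolyvaginAtTwoGenusPrimitiveSupplyAtTwoPrimeTwistDescAdmissible
import Literature.NumberTheory.GaloisRepresentations.UnramifiedKummer
import HarnessLib

/-!
# Route `GenusKolyvaginAtTwo`, crux #2 `GenusPrimitiveSupplyAtTwo` (stmt-BirchSwinnertonDyer-22136):
# DESC-§17-R UNCONDITIONAL — `F1Sign2.TwistSelmerEqRelaxedAtInfinityAtTwo` holds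

Width seat `bsd-line-gk2-p5` g14 (cell `bsd-f1-sign2`, SUPPLY lineage of crux 22136), file 33 of the series; sequel of file 32 (`…PrimeTwistInert`, the
K-general inert brick) and file 30 (`…PrimeTwistDescAdmissible`, DESC-§17-R modulo the inert comparison). THEOREMS ONLY (no definition, no named fact,
no `sorry`); helper `--supports stmt-BirchSwinnertonDyer-22136`; no item is closed; BSD is not proved by any of this.

WHAT.
* §135 `mem_maxUnramified_of_sq_eq_algebraMap` — over a non-archimedean local field `F` of characteristic `0` with `|2| = 1`, a square root in `F̄`
  of a UNIT of `F` lies in `F^{nr}` (an inertia element moving `z` to `−z` would have `|σz − z| = |2z| = 1`; `F^{nr}` is the fixed field of `I_F`).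
* §136–§137 `closureEmb_geomSqrt_mem_maxUnramified_of_not_dvd` — for `v ∤ 2d` the chosen copy `ι√d ∈ K̄_{ℚ_v}` lies in `ℚ_v^{nr}`.
* §138 `localChar_eq_one_iff_of_isQuadraticCharacterOf` — `χ_d (resGal τ) = 1 ↔ τ (ι√d) = ι√d` (the character hypothesis `hχα` of file 32).
* §139 **`primeTwist_selmerLocalKer_le_of_descAdmissible_of_inert`** — the displayed brick `hinert` of file 30's
  `twistSelmerEqRelaxedAtInfinityAtTwo_of_inertComparison`, DISCHARGED: at an odd good place with no local `√d`, `H¹_𝒜(ℚ_v) ≤ H¹_f(ℚ_v)` (over a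
  prime of `d`: `W(ℚ_v)[2] = 0`, file 30 §124; over `v ∤ d`: file 32's inert brick with §137–§138);
  **`twistSelmerEqRelaxedAtInfinityAtTwo_holds : F1Sign2.TwistSelmerEqRelaxedAtInfinityAtTwo`** — the cell's row DESC-§17-R BY NAME, unconditional.

Honest framing: KNOWN in print (Mazur–Rubin 2007 §§4–5 / 2010 §§2–3; Kramer 1981 Prop. 7; Serre, Local Fields IV §4); kernel-new; beyond-print
theorem: no. What it buys: the `T`-side of LINE 18/19 (`-desc` §17/§18, `-an` T-2q, U′/B⁰) may now quote `Sel_𝔓(A_χ) = Sel₂^{rel ∞}(W)` for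
descent-admissible `d` as a tree theorem. Crux 22136 stays OPEN exactly at (U) 24947 ∧ (CONV₂) 19220/24948. BSD is not proved by any of this.

References: [MazurRubin2007] Def 4.3, Cor 4.6, §5; [MazurRubin2010] Lemma 2.10, Def 3.1, Lemma 3.2; [SerreLocalFields1979] Ch. IV §4 Cor. 2 to
Prop. 16; [Kramer1981] Prop. 7.
-/

set_option linter.dupNamespace false -- tree convention: `Summit.BirchSwinnertonDyer.BirchSwinnertonDyer.Theorems` (summit = sub-problem)
set_option autoImplicit false

noncomputable section

open scoped Classical

namespace Summit.BirchSwinnertonDyer.BirchSwinnertonDyer.Theorems.GenusKolyArch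

open WeierstrassCurve Field NumberField IsDedekindDomain Function
open Literature.NumberTheory.EllipticCurves Literature.NumberTheory.GaloisRepresentations
open Literature.NumberTheory.GaloisRepresentations.IsNonarchimedeanLocalField
open Summit.BirchSwinnertonDyer.BirchSwinnertonDyer.Theorems.GenusKolyTwistLocal
open Summit.BirchSwinnertonDyer.Rank1Residual.F1Sign2
open Rat.HeightOneSpectrum (primesEquiv natGenerator)

/-! ## §135 Square roots of units are unramified away from `2` -/

section LocalField

variable {F : Type} [Field F] [ValuativeRel F] [TopologicalSpace F] [_root_.IsNonarchimedeanLocalField F]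

/-- An element of `F̄` fixed by the inertia group lies in `F^{nr}` (`I_F = Aut(F̄/F^{nr})` and the Galois correspondence for `F̄/F`; the
argument of the tree's private `Kramer1981.mem_maxUnramified_of_forall_absInertia`). [cite: SerreLocalFields1979, Ch. IV §4 Cor. 2 to Prop. 16] -/
theorem mem_maxUnramified_of_forall_absInertia_smul [CharZero F] {x : AlgebraicClosure F}
    (hx : ∀ σ ∈ absInertia F, σ • x = x) : x ∈ maxUnramified F := by
  haveI : IsGalois F (AlgebraicClosure F) := {}
  rw [← InfiniteGalois.fixedField_fixingSubgroup (maxUnramified F)]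
  intro τ
  have hτ : (absoluteGaloisGroup.toAlgEquiv F).symm
      (τ : AlgebraicClosure F ≃ₐ[F] AlgebraicClosure F) ∈ absInertia F := by
    rw [mem_absInertia_iff_forall_mem_maxUnramified]
    intro y hy
    rw [absoluteGaloisGroup.smul_def, MulEquiv.apply_symm_apply]
    exact (IntermediateField.mem_fixingSubgroup_iff _ _).1 τ.2 y hy
  have := hx _ hτ
  rw [absoluteGaloisGroup.smul_def, MulEquiv.apply_symm_apply] at this
  exact this

/-- **A square root of a unit is unramified when `|2| = 1`**: if `z² = u` in `F̄` with `v(u) = 1 = v(2)`, then `z ∈ F^{nr}` — an inertia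
element has `σz = ±z`, and `σz = −z` would give `|σz − z| = |2||z| = 1`, contradicting `σ ∈ I_F`.
[cite: SerreLocalFields1979, Ch. IV §4 Cor. 2 to Prop. 16] [cite: Kramer1981, Prop. 7] -/
theorem mem_maxUnramified_of_sq_eq_algebraMap [CharZero F] {z : AlgebraicClosure F} {u : F}
    (hz : z ^ 2 = algebraMap F (AlgebraicClosure F) u) (hu : ValuativeRel.valuation F u = 1)
    (h2 : ValuativeRel.valuation F (2 : F) = 1) : z ∈ maxUnramified F := by
  have hn1 : ∀ x : F, ValuativeRel.valuation F x = 1 → algNorm F (algebraMap F (AlgebraicClosure F) x) = 1 := fun x hx ↦ by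
    refine le_antisymm (algNorm_algebraMap_le_one_iff.mpr ((Valuation.mem_integer_iff _ _).mpr hx.le)) (not_lt.mp fun hlt ↦ ?_)
    rw [algNorm_algebraMap_lt_one_iff, hx] at hlt
    exact lt_irrefl _ hlt
  have hnu := hn1 u hu
  have hn2 : algNorm F (2 : AlgebraicClosure F) = 1 := by
    rw [← map_ofNat (algebraMap F (AlgebraicClosure F)) 2]
    exact hn1 2 h2
  have hnz : algNorm F z = 1 := by
    have h1 : algNorm F (z ^ 2) = 1 := by rw [hz, hnu]
    rw [algNorm_pow] at h1
    exact (pow_eq_one_iff_of_nonneg (algNorm_nonneg z) two_ne_zero).mp h1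
  refine mem_maxUnramified_of_forall_absInertia_smul fun σ hσ ↦ ?_
  have hσu : σ • (algebraMap F (AlgebraicClosure F) u) = algebraMap F (AlgebraicClosure F) u := by
    rw [absoluteGaloisGroup.smul_def, AlgEquiv.commutes]
  have h : (σ • z) ^ 2 = z ^ 2 := by rw [← smul_pow', hz, hσu]
  have h' : (σ • z - z) * (σ • z + z) = 0 := by linear_combination h
  rcases mul_eq_zero.mp h' with h1 | h1
  · exact sub_eq_zero.mp h1
  · exfalso
    have hneg : σ • z = -z := eq_neg_of_add_eq_zero_left h1
    have hlt := (mem_absInertia_iff_algNorm.mp hσ) z hnz.le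
    rw [hneg, show -z - z = -(2 * z) by ring, algNorm_neg, algNorm_mul, hn2, hnz, mul_one] at hlt
    exact lt_irrefl _ hlt

end LocalField

/-! ## §136–§137 `ι√d ∈ K_v^{nr}` for `v ∤ 2d` -/

section Completion

variable {K : Type} [Field K] [NumberField K] (v : HeightOneSpectrum (𝓞 K)) {d : K}

/-- **`ι√d ∈ K_v^{nr}` when `d` and `2` are `v`-units** (§135 applied to `(ι√d)² = d` in `K̄_v`). [cite: SerreLocalFields1979, Ch. IV §4 Cor. 2 to Prop. 16] -/
theorem closureEmb_geomSqrt_mem_maxUnramified_of_valuation_eq_one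
    (hd : ValuativeRel.valuation (v.adicCompletion K) (algebraMap K (v.adicCompletion K) d) = 1)
    (h2 : ValuativeRel.valuation (v.adicCompletion K) (2 : v.adicCompletion K) = 1) :
    closureEmb (K := K) (v.adicCompletion K) (geomSqrt d) ∈ maxUnramified (v.adicCompletion K) := by
  haveI : CharZero (v.adicCompletion K) := charZero_of_injective_algebraMap (algebraMap K _).injective
  exact mem_maxUnramified_of_sq_eq_algebraMap (closureEmb_geomSqrt_sq_eq_algebraMap (K := K) (d := d) v) hd h2

end Completion

section Rat

/-- `|d|_v = 1` for an integer `d` prime to the residue characteristic of `v` (in the valuation of the valuative relation of `ℚ_v`). [folklore] -/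
theorem valuation_adicCompletion_intCast_eq_one_of_not_dvd (v : HeightOneSpectrum (𝓞 ℚ)) {d : ℤ}
    (hpd : ¬ ((primesEquiv v : ℕ) : ℤ) ∣ d) :
    ValuativeRel.valuation (v.adicCompletion ℚ) (algebraMap ℚ (v.adicCompletion ℚ) (d : ℚ)) = 1 := by
  have hpP : (primesEquiv v : ℕ).Prime := (primesEquiv v).2
  have hpv : ((primesEquiv v : ℕ) : 𝓞 ℚ) ∈ v.asIdeal := Rat.HeightOneSpectrum.natCast_natGenerator_mem v
  have hnat : ¬ (primesEquiv v : ℕ) ∣ d.natAbs := fun h ↦ hpd (Int.natCast_dvd.mpr h)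
  have hn : ((d.natAbs : ℕ) : 𝓞 ℚ) ∉ v.asIdeal := GenusKolyTwistingPrime.natCast_not_mem_of_not_dvd hpP hpv hnat
  have h1 := valuation_adicCompletion_natCast_eq_one_of_not_mem v d.natAbs hn
  rw [map_intCast]
  rcases Int.natAbs_eq d with h | h
  · rw [h, Int.cast_natCast]
    exact h1
  · rw [h, Int.cast_neg, Int.cast_natCast, Valuation.map_neg]
    exact h1

/-- **`ι√d ∈ ℚ_v^{nr}` for `v ∤ 2d`** (the unramified quadratic `ℚ_v(√d)`). [cite: SerreLocalFields1979, Ch. IV §4 Cor. 2 to Prop. 16] [cite: Serre1973, Ch. II §3.3] -/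
theorem closureEmb_geomSqrt_mem_maxUnramified_of_not_dvd (v : HeightOneSpectrum (𝓞 ℚ)) {d : ℤ}
    (h2v : ((2 : ℕ) : 𝓞 ℚ) ∉ v.asIdeal) (hpd : ¬ ((primesEquiv v : ℕ) : ℤ) ∣ d) :
    closureEmb (K := ℚ) (v.adicCompletion ℚ) (geomSqrt (d : ℚ)) ∈ maxUnramified (v.adicCompletion ℚ) := by
  refine closureEmb_geomSqrt_mem_maxUnramified_of_valuation_eq_one v (valuation_adicCompletion_intCast_eq_one_of_not_dvd v hpd) ?_
  have h := valuation_adicCompletion_natCast_eq_one_of_not_mem v 2 h2v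
  rwa [Nat.cast_ofNat] at h

/-! ## §138 The character hypothesis `hχα` for `χ = χ_d` -/

/-- **`χ_d (resGal τ) = 1 ↔ τ (ι√d) = ι√d`** for `τ ∈ Γ_F`, `F` any `ℚ`-field: the chosen `ℚ̄ → F̄` intertwines `resGal τ` and `τ`
(`apply_resGalAuxOfEmb_apply`) and is injective. [cite: MazurRubin2007, §5] -/
theorem localChar_eq_one_iff_of_isQuadraticCharacterOf {χ : absoluteGaloisGroup ℚ →ₜ* Multiplicative (ZMod 2)} {d : ℤ}
    (hχ : IsQuadraticCharacterOf χ d) {F : Type} [Field F] [Algebra ℚ F] (τ : absoluteGaloisGroup F) :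
    χ (resGal (K := ℚ) F τ) = 1 ↔
      (show AlgebraicClosure F ≃ₐ[F] AlgebraicClosure F from τ) (closureEmb (K := ℚ) F (geomSqrt (d : ℚ))) =
        closureEmb (K := ℚ) F (geomSqrt (d : ℚ)) := by
  have hr : (geomSqrt (d : ℚ)) ^ 2 = ((d : ℚ) : AlgebraicClosure ℚ) := by
    rw [geomSqrt_sq, eq_ratCast]
  refine (hχ _ hr (resGal (K := ℚ) F τ)).trans ?_
  have hι : (closureEmb (K := ℚ) F) ((show AlgebraicClosure ℚ ≃ₐ[ℚ] AlgebraicClosure ℚ from resGal (K := ℚ) F τ) (geomSqrt (d : ℚ))) =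
      (show AlgebraicClosure F ≃ₐ[F] AlgebraicClosure F from τ) (closureEmb (K := ℚ) F (geomSqrt (d : ℚ))) :=
    apply_resGalAuxOfEmb_apply (closureEmb (K := ℚ) F) τ (geomSqrt (d : ℚ))
  rw [← hι]
  exact (closureEmb (K := ℚ) F).toRingHom.injective.eq_iff.symm

/-! ## §139 DESC-§17-R unconditional -/

/-- **The inert comparison at the descent-admissible places, DISCHARGED**: for a descent-admissible `d` with character `χ` and an odd good place `v`
of `ℚ` with no local `√d`, `H¹_𝒜(ℚ_v, E[2]) ≤ H¹_f(ℚ_v, E[2])` — over a prime of `d`, `W(ℚ_v)[2] = 0` makes both conditions everything killed by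
`res` (file 30 §124); over `v ∤ d`, `ℚ_v(√d)/ℚ_v` is the unramified quadratic extension and file 32's inert brick applies (`ι√d ∈ ℚ_v^{nr}` by §137,
`hχα` by §138). [cite: MazurRubin2010, Lemma 2.10 (v)] [cite: MazurRubin2007, Def 4.3, Cor 4.6 and §5] -/
theorem primeTwist_selmerLocalKer_le_of_descAdmissible_of_inert (W : WeierstrassCurve ℚ) [W.IsElliptic] [W.IsGloballyMinimal] {d : ℤ}
    {χ : absoluteGaloisGroup ℚ →ₜ* Multiplicative (ZMod 2)} (hd : DescAdmissible W d) (hχ : IsQuadraticCharacterOf χ d)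
    (v : HeightOneSpectrum (𝓞 ℚ)) (h2v : ((2 : ℕ) : 𝓞 ℚ) ∉ v.asIdeal) (hgood : W.HasGoodReductionAt v)
    (hns : ∀ s : v.adicCompletion ℚ, s ^ 2 ≠ algebraMap ℚ (v.adicCompletion ℚ) (d : ℚ)) :
    PrimeTwist.selmerLocalKer W χ (v.adicCompletion ℚ) ≤ W.selmerLocalKer (v.adicCompletion ℚ) 2 := by
  haveI := Fact.mk (primesEquiv v).2
  have hpP : (primesEquiv v : ℕ).Prime := (primesEquiv v).2
  have hpv : ((primesEquiv v : ℕ) : 𝓞 ℚ) ∈ v.asIdeal := Rat.HeightOneSpectrum.natCast_natGenerator_mem v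
  have hp2 : (primesEquiv v : ℕ) ≠ 2 := fun h ↦ h2v (by rw [← h]; exact hpv)
  by_cases hpd : ((primesEquiv v : ℕ) : ℤ) ∣ d
  · -- over a prime of `d`: odd, good, `a_p` odd ⟹ `W(ℚ_v)[2] = 0`
    obtain ⟨-, -, -, hprimes, -⟩ := hd
    obtain ⟨hgoodp, hodd⟩ := hprimes _ hpP hpd
    have hgood' : W.HasGoodReductionAtPrime (primesEquiv v : ℕ) := hgoodp inferInstance
    have hpΔ : ¬ ((primesEquiv v : ℕ) : ℤ) ∣ minimalDiscriminantInt W :=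
      W.not_dvd_minimalDiscriminantInt_of_hasGoodReductionAtPrime' _ hgood'
    have hsil := (GenusKolyTwin.silent_iff_odd_frobeniusTrace W hp2 hpΔ).mpr hodd
    have hker : Nat.card (nsmulAddMonoidHom 2 : (W.baseChange (v.adicCompletion ℚ)).toAffine.Point →+ _).ker = 1 := by
      rw [natCard_ker_nsmul_adicCompletion_eq_padic W v 2]
      have h0 := GenusKolyTwin.twoTorsion_padic_eq_zero_of_forall_ne W hp2 hpΔ hsil
      rw [Nat.card_eq_one_iff_unique]
      refine ⟨⟨fun a b ↦ Subtype.ext ((h0 a.1 a.2).trans (h0 b.1 b.2).symm)⟩, ⟨⟨0, by simp⟩⟩⟩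
    exact (primeTwist_selmerLocalKer_adicCompletion_eq_of_natCard_ker_eq_one W χ v h2v hker).le
  · -- over `v ∤ 2d`: the inert brick
    exact (primeTwist_selmerLocalKer_eq_of_inert W v χ hgood (closureEmb_geomSqrt_mem_maxUnramified_of_not_dvd v h2v hpd) hns
      (localChar_eq_one_iff_of_isQuadraticCharacterOf hχ)).le

/-- **DESC-§17-R (cell `bsd-f1-sign2`, row F1Sign2): `TwistSelmerEqRelaxedAtInfinityAtTwo` HOLDS** — for a globally minimal `W/ℚ`, a
descent-admissible `d` and its quadratic character `χ`: `Sel_𝔓(A_χ/ℚ) ≤ Sel₂^{rel ∞}(W/ℚ)` inside `H¹(ℚ, E[2])`, with equality as soon as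
`#Sel_𝔓(A_χ) = 2·#Sel₂(W)`. Assembly: file 30's `twistSelmerEqRelaxedAtInfinityAtTwo_of_inertComparison` with its one displayed brick discharged by
`primeTwist_selmerLocalKer_le_of_descAdmissible_of_inert`. Known in print (Mazur–Rubin); kernel-new; BSD is not proved by this.
[cite: MazurRubin2010, Def. 3.1, Lemma 3.2, Lemma 2.10] [cite: MazurRubin2007, Def 4.3, Cor 4.6, §5] [cite: Kramer1981, Prop. 7] -/
theorem twistSelmerEqRelaxedAtInfinityAtTwo_holds : TwistSelmerEqRelaxedAtInfinityAtTwo :=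
  twistSelmerEqRelaxedAtInfinityAtTwo_of_inertComparison fun W _ _ _ _ hd hχ v h2v hgood hns ↦
    primeTwist_selmerLocalKer_le_of_descAdmissible_of_inert W hd hχ v h2v hgood hns

end Rat

end Summit.BirchSwinnertonDyer.BirchSwinnertonDyer.Theorems.GenusKolyArch

end
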